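import Literature.MathematicalPhysics.QuantumFieldTheory.Balaban1983to89.Node00.MultiScaleFibreChartLocalityComponent
import Literature.MathematicalPhysics.QuantumFieldTheory.Balaban1983to89.B14Eq12InteriorLocality

/-!
# NODE 00 — THE CANONICAL MULTI-SCALE CHART DEPENDS ON `(U, W)` ONLY THROUGH THE LEVEL-≥1 DATA: `Ψ_{𝐁,W,U} = Ψ_{𝐁,W′,U′}` AS FUNCTIONS whenever `U = U′` on `inputsPos 𝐁` (the towers
# of the constrained bonds of levels ≥ 1), `W = W′` at levels ≥ 1, and both pairs lie in their fibres; the fibres `{X | U·e^X ∈ 𝔅(𝐁,W)}` and `{X | U′·e^X ∈ 𝔅(𝐁,W′)}` coincide;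
# hence the POS-PROXY currency — every chart-side binder at `U` from a guarded proxy `U′` agreeing with `U` on `inputsPos 𝐁` ONLY (the Γ₀ layer is free)

Cell `pub-ymgap`, width seat `pub-ymgap-dag-n12-w4` generation 4 (HUMAN RULING D-0149; lane N12 = [16] = [Balaban1989LargeFieldII] Prop. 1 ∕ (1.77)); INBOX CLAIM-3 ∕ INTENT-5 of 2026-08-28,
on the lane owner's word (dag-n12-c g19: «LOCAL-OK for `chartLetter_of_letters_N` from C1 + Cin_N?»).  `--kind proof --supports stmt-QuantumFields-27364` (K1⁹; count-neutral).
The sequel of this seat's `Node00.MultiScaleFibreChartLocality` (p620013∕p622573: proxies agreeing on ALL of `inputs 𝐁`) and `…LocalityComponent` (p632873: component locality + the exact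
Γ₀ layer).  CONSUMED BY NAME, nothing modified: those two, `B14.Eq12InteriorLocality.inputsPos` ∕ `mem_inputsPos` (r-lineage), `B14.Eq216Concrete.iter_local`, n07-w2's `Node00.msChart`,
this seat's p610492 ∕ p613093 ∕ p615328 letters (`exists_lam_of_isFibreChartNear_of_isCritOnFibre`, `exists_chartCurvature_sq_bound_seminorm`, `exists_uniform_chartCurvature_sq_bound`,
`hasFDerivAt_fderiv_msChart`, …).

WHY (the lane's (σ)_N ∕ (χ)_N road, dag-n12-c g19 + dag-n12-w6 g2 (gN3)).  The gauge letter delivers near-flatness of the minimiser on a bond set `N ⊇ inputsPos 𝐁_k(Z)` (plus the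
`Ω₁`-plaquette bonds), NOT on the far Γ₀ layer where the configuration is the raw datum.  §1 shows the chart does not see that layer at all: at a level-0 constrained bond both
`Ψ_{W,U}` and `Ψ_{W′,U′}` are `π log e^{X_c}` (the datum cancels on the fibre), and at levels ≥ 1 the components read `feeds j c ⊆ inputsPos 𝐁`; likewise for the fibres.  §2 builds the
Pos proxy (`U′ := U` on a set `S ⊇ inputsPos 𝐁`, `1` elsewhere; `W′ := W` at levels ≥ 1, `M˙U′` at level 0) and §3 re-derives this seat's `_of_proxy` binders in that currency.

CONTENTS (namespace `Literature.MathematicalPhysics.QuantumFieldTheory.Balaban1983to89.Node00`; theorems only — no `def`, no `instance`, no `sorry`).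
* §1 ★★ `msChart_eq_of_levelPosData`, ★ `agreeOn_expChart_iff_of_levelPosData`, `isFibreChartNear_iff_of_levelPosData`.
* §2 ★ `exists_proxyPos` (the Pos proxy pair from near-flatness on `S ⊇ inputsPos 𝐁` and the fibre condition).
* §3 `regularity_triple_msChart_of_proxyPos` (strict differentiability, `hΨ₂`, `hΨd`),
  `eventually_agreeOn_of_msChart_eq_of_proxyPos`, ★ `isFibreChartNear_msChart_of_surjective_of_proxyPos`, ★★ `exists_lam_msChart_of_surjective_of_proxyPos`,
  ★ `exists_lam_msChart_bound_of_rightInverse_fun_of_proxyPos`, ★★ `exists_lam_mu_msChart_of_rightInverse_fun_of_proxyPos`; §4 ★★ `exists_uniform_chartCurvature_sq_bound_localPos`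
  (near-flatness asked only on `inputsPos 𝐁`).

HONEST FRAMING.  Bookkeeping over landed theorems; the (μ) row's CURRENT letter still reads the true `U` on the plaquettes touching the range of the right inverse (not addressed here);
nothing of Bałaban's asserted; count-neutral; NOT a discharge of N12; K1⁹ NOT closed; one finite four-torus programme at fixed `ε = L^{-K}` — nothing continuum ∕ ℝ⁴ ∕ OS ∕ mass gap ∕ Clay.

## References
* [Balaban1988Convergent] T. Bałaban, Commun. Math. Phys. 119 (1988) 243–285, (2.2) p. 255, (2.10)–(2.13) pp. 256–257.
* [Balaban1985Variational] T. Bałaban, Commun. Math. Phys. 102 (1985) 277–309, (3) p. 278, Sect. C (44)–(48) p. 285, (81)–(83) p. 290, p. 300.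
* [Balaban1989LargeFieldII] T. Bałaban, Commun. Math. Phys. 122 (1989) 355–392, p. 357, (1.12)–(1.13) p. 359, (1.77) p. 373.
* [Balaban1987RG1] T. Bałaban, Commun. Math. Phys. 109 (1987) 249–301, (0.4) p. 253, (0.21) p. 256.
-/

noncomputable section

namespace Literature.MathematicalPhysics.QuantumFieldTheory.Balaban1983to89.Node00

open Filter Topology
open T4Continuum (T4Family)
open B15DeterminingSets
open B14.Eq216Concrete (feeds inputs mem_inputs iter_local)
open B14.Eq12InteriorLocality (inputsPos mem_inputsPos)
open T4AdjointCovarianceUnitary (lieSU expSU)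
open scoped Matrix.Norms.L2Operator

variable {F : T4Family} {N : ℕ} [NeZero N]
variable {K k : ℕ} {𝔹 : DetSet (F.P K)} {W W' : MSField (F.P K) (SU N)} {U U' : GaugeField (F.P K) 0 (SU N)}

/-! ## §1  The chart and its fibre see only the level-≥1 data -/

/-- ★★ **THE CHART DEPENDS ON `(U, W)` ONLY THROUGH THE LEVEL-≥1 DATA** (standing range `k ≤ m + K`): if `U′ = U` on `inputsPos 𝐁`, `W′ = W` on the constrained bonds of levels ≥ 1,
and both `U`, `U′` lie in the fibres of `W`, `W′`, then `Ψ_{𝐁,W,U} = Ψ_{𝐁,W′,U′}` AS FUNCTIONS.  Levels ≥ 1: component locality (`iter_local` on `feeds j c ⊆ inputsPos 𝐁`); level 0: on the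
fibre the datum cancels — both components are `π(log(e^{X_c}))`. [cite: Balaban1988Convergent, (2.2) p.255, (2.10)–(2.11) p.256; Balaban1985Variational, Sect. C (47)–(48) p.285, (82)–(83) p.290] -/
theorem msChart_eq_of_levelPosData (hk : k ≤ (F.P K).m + (F.P K).K) (hin : ∀ b ∈ inputsPos 𝔹, U' b = U b)
    (hU : AgreeOn 𝔹 (avgFamily (avOfRecord F N K) U) W) (hU' : AgreeOn 𝔹 (avgFamily (avOfRecord F N K) U') W')
    (hW : ∀ j, 1 ≤ j → ∀ c ∈ bondsOf (𝔹 j), W' j c = W j c) :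
    msChart F N K k 𝔹 W U = msChart F N K k 𝔹 W' U' := by
  funext X i
  rw [msChart_apply, msChart_apply]
  generalize (constrEnum 𝔹 k).symm i = s
  obtain ⟨⟨j, hjk⟩, c, hc⟩ := s
  cases j with
  | zero =>
    -- level 0: the datum cancels on the fibre
    have h0 : W 0 c = U c := (hU 0 c hc).symm
    have h0' : W' 0 c = U' c := (hU' 0 c hc).symm
    show suProj N (MatrixLog.mlog (relAvg K W (expChart U X) 0 c)) = suProj N (MatrixLog.mlog (relAvg K W' (expChart U' X) 0 c))
    rw [relAvg, relAvg, h0, h0']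
    show suProj N (MatrixLog.mlog (star ((U c : SU N) : Matrix (Fin N) (Fin N) ℂ) * ((expChart U X c : SU N) : Matrix (Fin N) (Fin N) ℂ)))
      = suProj N (MatrixLog.mlog (star ((U' c : SU N) : Matrix (Fin N) (Fin N) ℂ) * ((expChart U' X c : SU N) : Matrix (Fin N) (Fin N) ℂ)))
    rw [coe_expChart, coe_expChart, ← mul_assoc, ← mul_assoc, star_coe_mul_coe_SU, star_coe_mul_coe_SU]
  | succ j =>
    -- levels ≥ 1: component locality on `feeds (j+1) c ⊆ inputsPos 𝐁`
    have hj : j + 1 ≤ (F.P K).m + (F.P K).K := (Nat.le_of_lt_succ hjk).trans hk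
    have hav : avgFamily (avOfRecord F N K) (expChart U X) (j + 1) c = avgFamily (avOfRecord F N K) (expChart U' X) (j + 1) c :=
      iter_local (avOfRecord F N K) (j + 1) hj _ _ c fun b hb => by
        unfold expChart
        rw [hin b (mem_inputsPos.2 ⟨j, c, hc, hb⟩)]
    show suProj N (MatrixLog.mlog (relAvg K W (expChart U X) (j + 1) c)) = suProj N (MatrixLog.mlog (relAvg K W' (expChart U' X) (j + 1) c))
    rw [relAvg, relAvg, hav, hW (j + 1) (Nat.succ_pos j) c hc]

/-- ★ **THE FIBRES COINCIDE**: under the same hypotheses, for EVERY chart variable `X`, `U·e^X` lies in the fibre of `W` iff `U′·e^X` lies in the fibre of `W′` — levels ≥ 1 by locality, level 0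
because both conditions read `U(c)·e^{X_c} = U(c)` resp. `U′(c)·e^{X_c} = U′(c)`, i.e. `e^{X_c} = 1`. [cite: Balaban1988Convergent, (2.2) p.255, (2.10)–(2.11) p.256; Balaban1985Variational, (3) p.278] -/
theorem agreeOn_expChart_iff_of_levelPosData (hk : k ≤ (F.P K).m + (F.P K).K) (h𝔹 : ∀ j, k < j → 𝔹 j = ∅) (hin : ∀ b ∈ inputsPos 𝔹, U' b = U b)
    (hU : AgreeOn 𝔹 (avgFamily (avOfRecord F N K) U) W) (hU' : AgreeOn 𝔹 (avgFamily (avOfRecord F N K) U') W')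
    (hW : ∀ j, 1 ≤ j → ∀ c ∈ bondsOf (𝔹 j), W' j c = W j c) (X : PBond (F.P K) 0 → lieSU (Fin N)) :
    AgreeOn 𝔹 (avgFamily (avOfRecord F N K) (expChart U X)) W ↔ AgreeOn 𝔹 (avgFamily (avOfRecord F N K) (expChart U' X)) W' := by
  have key : ∀ (j : ℕ) (c : PBond (F.P K) j), c ∈ bondsOf (𝔹 j) →
      (avgFamily (avOfRecord F N K) (expChart U X) j c = W j c ↔ avgFamily (avOfRecord F N K) (expChart U' X) j c = W' j c) := by
    intro j c hc
    cases j with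
    | zero =>
      have h0 : W 0 c = U c := (hU 0 c hc).symm
      have h0' : W' 0 c = U' c := (hU' 0 c hc).symm
      show expChart U X c = W 0 c ↔ expChart U' X c = W' 0 c
      rw [h0, h0']
      show U c * expSU (X c) = U c ↔ U' c * expSU (X c) = U' c
      rw [mul_eq_left, mul_eq_left]
    | succ j =>
      by_cases hjk : j + 1 ≤ k
      · have hj : j + 1 ≤ (F.P K).m + (F.P K).K := hjk.trans hk
        have hav : avgFamily (avOfRecord F N K) (expChart U X) (j + 1) c = avgFamily (avOfRecord F N K) (expChart U' X) (j + 1) c :=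
          iter_local (avOfRecord F N K) (j + 1) hj _ _ c fun b hb => by
            unfold expChart
            rw [hin b (mem_inputsPos.2 ⟨j, c, hc, hb⟩)]
        rw [hav, hW (j + 1) (Nat.succ_pos j) c hc]
      · exfalso
        rw [h𝔹 (j + 1) (lt_of_not_ge hjk)] at hc
        simp [bondsOf] at hc
  exact ⟨fun h j c hc => (key j c hc).1 (h j c hc), fun h j c hc => (key j c hc).2 (h j c hc)⟩

/-- **`IsFibreChartNear` transfers along the level-≥1 data** (for any candidate chart `Φ`, `Φ′`: only its fibre clause mentions `(U, W)`).
[cite: Balaban1985Variational, (82)–(83) p.290; Balaban1988Convergent, (2.10)–(2.12) p.256] -/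
theorem isFibreChartNear_iff_of_levelPosData (hk : k ≤ (F.P K).m + (F.P K).K) (h𝔹 : ∀ j, k < j → 𝔹 j = ∅) (hin : ∀ b ∈ inputsPos 𝔹, U' b = U b)
    (hU : AgreeOn 𝔹 (avgFamily (avOfRecord F N K) U) W) (hU' : AgreeOn 𝔹 (avgFamily (avOfRecord F N K) U') W')
    (hW : ∀ j, 1 ≤ j → ∀ c ∈ bondsOf (𝔹 j), W' j c = W j c)
    {V : Type*} [NormedAddCommGroup V] [NormedSpace ℝ V] [FiniteDimensional ℝ V]
    {Φ : (PBond (F.P K) 0 → lieSU (Fin N)) → V} {Φ' : (PBond (F.P K) 0 → lieSU (Fin N)) →L[ℝ] V} :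
    IsFibreChartNear F N K 𝔹 W U Φ Φ' ↔ IsFibreChartNear F N K 𝔹 W' U' Φ Φ' := by
  unfold IsFibreChartNear
  refine and_congr_right fun _ => and_congr_right fun _ => Filter.eventually_congr (Filter.Eventually.of_forall fun X => ?_)
  exact imp_congr_right fun _ => agreeOn_expChart_iff_of_levelPosData hk h𝔹 hin hU hU' hW X

/-! ## §2  The Pos proxy: flatten off a set `S ⊇ inputsPos 𝐁`, re-pin the level-0 datum -/

/-- ★ **THE POS PROXY PAIR**: for `U` in the fibre of `W` on `𝐁` (standing range) and `ρ`-near-flat on a bond set `S ⊇ inputsPos 𝐁`, there are `U′` (`= U` on `S`, `1` elsewhere; globally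
`ρ`-near-flat) and a datum `W′` (`= W` at levels ≥ 1, `M˙U′` at level 0) with `U′` in the fibre of `W′`. [cite: Balaban1989LargeFieldII, (1.77) p.373; Balaban1988Convergent, (2.10)–(2.11) p.256] -/
theorem exists_proxyPos (hk : k ≤ (F.P K).m + (F.P K).K) (h𝔹 : ∀ j, k < j → 𝔹 j = ∅) (U : GaugeField (F.P K) 0 (SU N)) (W : MSField (F.P K) (SU N))
    (hU : AgreeOn 𝔹 (avgFamily (avOfRecord F N K) U) W) (S : Set (PBond (F.P K) 0)) (hS : inputsPos 𝔹 ⊆ S) {ρ : ℝ} (hρ : 0 ≤ ρ)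
    (hloc : ∀ b ∈ S, ‖((U b : SU N) : Matrix (Fin N) (Fin N) ℂ) - 1‖ ≤ ρ) :
    ∃ (U' : GaugeField (F.P K) 0 (SU N)) (W' : MSField (F.P K) (SU N)),
      (∀ b ∈ S, U' b = U b) ∧ ‖coeField U' - 1‖ ≤ ρ ∧ (∀ j, 1 ≤ j → ∀ c ∈ bondsOf (𝔹 j), W' j c = W j c) ∧
        AgreeOn 𝔹 (avgFamily (avOfRecord F N K) U') W' := by
  obtain ⟨U', hin, hflat⟩ := exists_nearFlat_eqOn U S hρ hloc
  refine ⟨U', fun j => match j with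
      | 0 => avgFamily (avOfRecord F N K) U' 0
      | j + 1 => W (j + 1), hin, hflat, ?_, ?_⟩
  · intro j hj c _
    obtain ⟨j, rfl⟩ : ∃ j', j = j' + 1 := ⟨j - 1, by omega⟩
    rfl
  · intro j c hc
    cases j with
    | zero => rfl
    | succ j =>
      by_cases hjk : j + 1 ≤ k
      · have hj : j + 1 ≤ (F.P K).m + (F.P K).K := hjk.trans hk
        show avgFamily (avOfRecord F N K) U' (j + 1) c = W (j + 1) c
        rw [← hU (j + 1) c hc]
        exact iter_local (avOfRecord F N K) (j + 1) hj _ _ c fun b hb => hin b (hS (mem_inputsPos.2 ⟨j, c, hc, hb⟩))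
      · exfalso
        rw [h𝔹 (j + 1) (lt_of_not_ge hjk)] at hc
        simp [bondsOf] at hc

/-! ## §3  Pos-proxy currency: the chart binders at `U` from a guarded proxy pair `(U′, W′)` agreeing with `(U, W)` on the level-≥1 data -/

section ProxyPos

variable (hk : k ≤ (F.P K).m + (F.P K).K) (h𝔹 : ∀ j, k < j → 𝔹 j = ∅) (hin : ∀ b ∈ inputsPos 𝔹, U' b = U b)
  (hU : AgreeOn 𝔹 (avgFamily (avOfRecord F N K) U) W) (hU' : AgreeOn 𝔹 (avgFamily (avOfRecord F N K) U') W')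
  (hW : ∀ j, 1 ≤ j → ∀ c ∈ bondsOf (𝔹 j), W' j c = W j c) (hsb' : SmallBelow (avOfRecord F N K) k U')
include hk hin hU hU' hW hsb'

/-- **THE REGULARITY TRIPLE AT `(U, W)` FROM A GUARDED POS PROXY**: strict differentiability of the chart at `0` (hence the binder `hΨ`), and J-C's pair `hΨ₂` ∕ `hΨd` —
p610492's binders AT THE PROXY PAIR, transported by §1 (the chart at `(U, W)` IS the chart at `(U′, W′)`). [cite: Balaban1985Variational, (81)–(83) p.290] -/
theorem regularity_triple_msChart_of_proxyPos :
    HasStrictFDerivAt (msChart F N K k 𝔹 W U) (fderiv ℝ (msChart F N K k 𝔹 W U) 0) 0 ∧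
      HasFDerivAt (fun Y => fderiv ℝ (msChart F N K k 𝔹 W U) Y) (fderiv ℝ (fderiv ℝ (msChart F N K k 𝔹 W U)) 0) 0 ∧
      ∀ᶠ Y in 𝓝 (0 : PBond (F.P K) 0 → lieSU (Fin N)), DifferentiableAt ℝ (msChart F N K k 𝔹 W U) Y := by
  rw [msChart_eq_of_levelPosData hk hin hU hU' hW]
  exact ⟨hasStrictFDerivAt_msChart hU' hsb', hasFDerivAt_fderiv_msChart hU' hsb', eventually_differentiableAt_msChart hU' hsb'⟩

include h𝔹 in
/-- The level set of the chart through `0` lies in the fibre of `W` near `0`, at `U`, from a guarded Pos proxy. [cite: Balaban1985Variational, (3) p.278, (82)–(83) p.290; Balaban1988Convergent, (2.10) p.256] -/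
theorem eventually_agreeOn_of_msChart_eq_of_proxyPos :
    ∀ᶠ X in 𝓝 (0 : PBond (F.P K) 0 → lieSU (Fin N)),
      msChart F N K k 𝔹 W U X = msChart F N K k 𝔹 W U 0 → AgreeOn 𝔹 (avgFamily (avOfRecord F N K) (expChart U X)) W := by
  rw [msChart_eq_of_levelPosData hk hin hU hU' hW]
  filter_upwards [eventually_agreeOn_of_msChart_eq h𝔹 hU' hsb'] with X hX hΦ
  exact (agreeOn_expChart_iff_of_levelPosData hk h𝔹 hin hU hU' hW X).2 (hX hΦ)

include h𝔹 in
/-- ★ **`IsFibreChartNear` FOR THE CANONICAL CHART AT `(U, W)` FROM A GUARDED POS PROXY**, once `DΨ(0)` is onto. [cite: Balaban1985Variational, (45)–(48) p.285, (82)–(83) p.290; Balaban1988Convergent, (2.10)–(2.12) p.256] -/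
theorem isFibreChartNear_msChart_of_surjective_of_proxyPos (hsurj : Function.Surjective (fderiv ℝ (msChart F N K k 𝔹 W U) 0)) :
    IsFibreChartNear F N K 𝔹 W U (msChart F N K k 𝔹 W U) (fderiv ℝ (msChart F N K k 𝔹 W U) 0) :=
  ⟨(regularity_triple_msChart_of_proxyPos hk hin hU hU' hW hsb').1, LinearMap.range_eq_top.2 hsurj,
    eventually_agreeOn_of_msChart_eq_of_proxyPos hk h𝔹 hin hU hU' hW hsb'⟩

include h𝔹 in
/-- ★★ **THE LAGRANGE MULTIPLIER AT `U` WITH NEAR-FLATNESS ASKED ONLY THROUGH THE POS PROXY**: `DΨ(0)` onto and `U` curve-critical on the fibre of `W` ⇒ `D(A∘expChart U)(0) = λ ∘ DΨ(0)`.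
[cite: Balaban1985Variational, (82)–(83) p.290, p.300; Balaban1989LargeFieldII, (1.12) p.359] -/
theorem exists_lam_msChart_of_surjective_of_proxyPos (hsurj : Function.Surjective (fderiv ℝ (msChart F N K k 𝔹 W U) 0)) (hcrit : IsCritOnFibre F N K 𝔹 W U) :
    ∃ lam : (Fin (constrCard 𝔹 k) → lieSU (Fin N)) →L[ℝ] ℝ,
      fderiv ℝ (fun Y : PBond (F.P K) 0 → lieSU (Fin N) => wilsonAction4 (expChart U Y)) 0 = lam.comp (fderiv ℝ (msChart F N K k 𝔹 W U) 0) :=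
  exists_lam_of_isFibreChartNear_of_isCritOnFibre (isFibreChartNear_msChart_of_surjective_of_proxyPos hk h𝔹 hin hU hU' hW hsb' hsurj) hcrit

include h𝔹 in
/-- ★ **THE MULTIPLIER AND ITS BOUND `|λ v| ≤ j·ρ·q v` AT `U` FROM A GUARDED POS PROXY** (the current letter `hj` still reads the TRUE `U`). [cite: Balaban1989LargeFieldII, (1.12) p.359; Balaban1985Variational, (82)–(83) p.290, p.300] -/
theorem exists_lam_msChart_bound_of_rightInverse_fun_of_proxyPos
    (p : Seminorm ℝ (PBond (F.P K) 0 → lieSU (Fin N))) (q : (Fin (constrCard 𝔹 k) → lieSU (Fin N)) → ℝ)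
    {R : (Fin (constrCard 𝔹 k) → lieSU (Fin N)) → PBond (F.P K) 0 → lieSU (Fin N)} (hR : ∀ v, fderiv ℝ (msChart F N K k 𝔹 W U) 0 (R v) = v)
    {j ρ : ℝ} (hj0 : 0 ≤ j) (hj : ∀ x, |fderiv ℝ (fun Y : PBond (F.P K) 0 → lieSU (Fin N) => wilsonAction4 (expChart U Y)) 0 x| ≤ j * p x)
    (hρ : ∀ v, p (R v) ≤ ρ * q v) (hcrit : IsCritOnFibre F N K 𝔹 W U) :
    ∃ lam : (Fin (constrCard 𝔹 k) → lieSU (Fin N)) →L[ℝ] ℝ,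
      fderiv ℝ (fun Y : PBond (F.P K) 0 → lieSU (Fin N) => wilsonAction4 (expChart U Y)) 0 = lam.comp (fderiv ℝ (msChart F N K k 𝔹 W U) 0) ∧
        ∀ v, |lam v| ≤ j * ρ * q v := by
  obtain ⟨lam, hlam⟩ := exists_lam_msChart_of_surjective_of_proxyPos hk h𝔹 hin hU hU' hW hsb' (fun v => ⟨R v, hR v⟩) hcrit
  exact ⟨lam, hlam, fun v => B16Ineq17NearFlatOneSidedSeminorm.abs_multiplier_apply_le_seminorm p q _ _ hR hlam hj0 hj hρ v⟩

include h𝔹 in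
/-- ★★ **THE PAIR (`hlam`, `μ`) AT `U` FROM A GUARDED POS PROXY**: the multiplier identity and `λ(D²Ψ(0)(w,w)) ≤ μ·p(w)²` with `μ = j·ρ·N·M₂ ≥ 0`.
[cite: Balaban1989LargeFieldII, (1.12) p.359; Balaban1985Variational, (81)–(83) p.290, p.300] -/
theorem exists_lam_mu_msChart_of_rightInverse_fun_of_proxyPos
    (p : Seminorm ℝ (PBond (F.P K) 0 → lieSU (Fin N)))
    (hp : ∀ Y : PBond (F.P K) 0 → lieSU (Fin N), ∑ b, ‖(Y b : Matrix (Fin N) (Fin N) ℂ)‖ ^ 2 ≤ p Y ^ 2)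
    {R : (Fin (constrCard 𝔹 k) → lieSU (Fin N)) → PBond (F.P K) 0 → lieSU (Fin N)} (hR : ∀ v, fderiv ℝ (msChart F N K k 𝔹 W U) 0 (R v) = v)
    {j ρ : ℝ} (hj0 : 0 ≤ j) (hρ0 : 0 ≤ ρ)
    (hj : ∀ x, |fderiv ℝ (fun Y : PBond (F.P K) 0 → lieSU (Fin N) => wilsonAction4 (expChart U Y)) 0 x| ≤ j * p x)
    (hρ : ∀ v, p (R v) ≤ ρ * ‖v‖) (hcrit : IsCritOnFibre F N K 𝔹 W U) :
    ∃ lam : (Fin (constrCard 𝔹 k) → lieSU (Fin N)) →L[ℝ] ℝ, ∃ μ : ℝ, 0 ≤ μ ∧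
      fderiv ℝ (fun Y : PBond (F.P K) 0 → lieSU (Fin N) => wilsonAction4 (expChart U Y)) 0 = lam.comp (fderiv ℝ (msChart F N K k 𝔹 W U) 0) ∧
        ∀ w : PBond (F.P K) 0 → lieSU (Fin N), lam (fderiv ℝ (fderiv ℝ (msChart F N K k 𝔹 W U)) 0 w w) ≤ μ * p w ^ 2 := by
  obtain ⟨lam, hlam, hbd⟩ := exists_lam_msChart_bound_of_rightInverse_fun_of_proxyPos hk h𝔹 hin hU hU' hW hsb' p (fun v => ‖v‖) hR hj0 hj hρ hcrit
  obtain ⟨M₂, hM₂, hcurv⟩ := exists_chartCurvature_sq_bound_seminorm (F := F) (N := N) (K := K) (k := k) (𝔹 := 𝔹) (W := W) (U := U) p hp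
  refine ⟨lam, j * ρ * (N * M₂), by positivity, hlam, fun w => ?_⟩
  calc lam (fderiv ℝ (fderiv ℝ (msChart F N K k 𝔹 W U)) 0 w w)
        ≤ |lam (fderiv ℝ (fderiv ℝ (msChart F N K k 𝔹 W U)) 0 w w)| := le_abs_self _
    _ ≤ j * ρ * ‖fderiv ℝ (fderiv ℝ (msChart F N K k 𝔹 W U)) 0 w w‖ := hbd _
    _ ≤ j * ρ * (N * M₂ * p w ^ 2) := mul_le_mul_of_nonneg_left (hcurv w) (by positivity)
    _ = j * ρ * (N * M₂) * p w ^ 2 := by ring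

end ProxyPos

/-! ## §4  Near-flat-on-`inputsPos` currency: the uniform curvature bound and the regularity binders, Pos edition -/

/-- ★★ **THE UNIFORM CURVATURE BOUND, POS EDITION**: `M₂ ≥ 0` and `ρ″ > 0` per height such that for every determining set `𝐁` with no member above `k ≤ m + K`, every datum `W` and every
`U₀` in the fibre that is `ρ″`-near-flat ON `inputsPos 𝐁` ONLY (the Γ₀ layer free): the chart is differentiable at `0`, `Y ↦ DΨ(Y)` is differentiable at `0`, and
`‖D²Ψ_{U₀}(0)(w,w)‖ ≤ M₂‖w‖²` — p615328's `exists_uniform_chartCurvature_sq_bound` at the Pos proxy pair, transported by §1.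
[cite: Balaban1985Variational, (81)–(83) p.290; Balaban1987RG1, (0.4) p.253; Balaban1988Convergent, (2.2) p.255, (2.10)–(2.12) p.256] -/
theorem exists_uniform_chartCurvature_sq_bound_localPos (k : ℕ) :
    ∃ M₂ ρ'' : ℝ, 0 ≤ M₂ ∧ 0 < ρ'' ∧
      ∀ (𝔹 : DetSet (F.P K)) (W : MSField (F.P K) (SU N)) (U₀ : GaugeField (F.P K) 0 (SU N)),
        (∀ j, k < j → 𝔹 j = ∅) → k ≤ (F.P K).m + (F.P K).K →
        (∀ b ∈ inputsPos 𝔹, ‖((U₀ b : SU N) : Matrix (Fin N) (Fin N) ℂ) - 1‖ ≤ ρ'') → AgreeOn 𝔹 (avgFamily (avOfRecord F N K) U₀) W →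
        DifferentiableAt ℝ (msChart F N K k 𝔹 W U₀) 0 ∧
        HasFDerivAt (fun Y => fderiv ℝ (msChart F N K k 𝔹 W U₀) Y) (fderiv ℝ (fderiv ℝ (msChart F N K k 𝔹 W U₀)) 0) 0 ∧
        ∀ w : PBond (F.P K) 0 → lieSU (Fin N), ‖fderiv ℝ (fderiv ℝ (msChart F N K k 𝔹 W U₀)) 0 w w‖ ≤ M₂ * ‖w‖ ^ 2 := by
  obtain ⟨M₂, ρ'', hM₂, hρ, hguard, hcurv⟩ := exists_uniform_chartCurvature_sq_bound (F := F) (N := N) (K := K) k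
  refine ⟨M₂, ρ'', hM₂, hρ, fun 𝔹 W U₀ h𝔹 hk hloc hU => ?_⟩
  obtain ⟨U', W', hin, hflat, hW, hU'⟩ := exists_proxyPos hk h𝔹 U₀ W hU (inputsPos 𝔹) subset_rfl hρ.le hloc
  have hsb' : SmallBelow (avOfRecord F N K) k U' := hguard U' hflat
  have hreg := regularity_triple_msChart_of_proxyPos hk hin hU hU' hW hsb'
  refine ⟨hreg.1.hasFDerivAt.differentiableAt, hreg.2.1, fun w => ?_⟩
  rw [msChart_eq_of_levelPosData hk hin hU hU' hW]
  exact hcurv 𝔹 W' U' hflat hU' w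

/-- ★★ **ONE RADIUS PER HEIGHT FOR POS PROXIES**: there is `ρ″ > 0` such that every `U` in the fibre of `W` on `𝐁` (no member above `k ≤ m + K`) that is `ρ″`-near-flat ON
`inputsPos 𝐁` has a GUARDED Pos proxy pair `(U′, W′)` — `U′ = U` on `inputsPos 𝐁`, globally `ρ″`-near-flat, guarded below `k`, `W′ = W` at levels ≥ 1, `U′` in the fibre of `W′`.
[cite: Balaban1987RG1, (0.4) p.253, (0.21) p.256; Balaban1988Convergent, (2.10)–(2.11) p.256] -/
theorem exists_radius_proxyPos (k : ℕ) :
    ∃ ρ'' : ℝ, 0 < ρ'' ∧ ∀ (𝔹 : DetSet (F.P K)) (W : MSField (F.P K) (SU N)) (U : GaugeField (F.P K) 0 (SU N)),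
      (∀ j, k < j → 𝔹 j = ∅) → k ≤ (F.P K).m + (F.P K).K →
      (∀ b ∈ inputsPos 𝔹, ‖((U b : SU N) : Matrix (Fin N) (Fin N) ℂ) - 1‖ ≤ ρ'') → AgreeOn 𝔹 (avgFamily (avOfRecord F N K) U) W →
      ∃ (U' : GaugeField (F.P K) 0 (SU N)) (W' : MSField (F.P K) (SU N)),
        (∀ b ∈ inputsPos 𝔹, U' b = U b) ∧ ‖coeField U' - 1‖ ≤ ρ'' ∧ SmallBelow (avOfRecord F N K) k U' ∧
        (∀ j, 1 ≤ j → ∀ c ∈ bondsOf (𝔹 j), W' j c = W j c) ∧ AgreeOn 𝔹 (avgFamily (avOfRecord F N K) U') W' := by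
  obtain ⟨_, ρ'', _, hρ, hguard, _⟩ := exists_uniform_chartCurvature_sq_bound (F := F) (N := N) (K := K) k
  refine ⟨ρ'', hρ, fun 𝔹 W U h𝔹 hk hloc hU => ?_⟩
  obtain ⟨U', W', hin, hflat, hW, hU'⟩ := exists_proxyPos hk h𝔹 U W hU (inputsPos 𝔹) subset_rfl hρ.le hloc
  exact ⟨U', W', hin, hflat, hguard U' hflat, hW, hU'⟩

end Literature.MathematicalPhysics.QuantumFieldTheory.Balaban1983to89.Node00

end
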